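import Summits.FinalStateConjecture.FinalStateConjecture.Theorems.BartnikGapSettlingBondiBartnikRigidityMarchingLemmaChartData
import Literature.Geometry.Lorentzian.RelativeDevelopmentGluingCauchy
import Literature.Geometry.Lorentzian.CausalityChronologyProofs
import Literature.Geometry.Lorentzian.MinkowskiGlobalHyperbolicity
import HarnessLib

/-!
# K2b-5 `stub_marchingLemma`, brick 11: gluing two exact charts — line `direct-method-on-the-cone`
# (crux `BondiBartnikRigidity`, stmt-FinalStateConjecture-10807)

The gluing step of the marching (report K2b-a2 §4, "Ψ_{τ+h} = Ψ_τ on Q, = (kite chart) on K"):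

* `glue` — two exact (smooth, deviation `0`, orientation preserving, open embedding) charts `Ψ₁` on
  `pullK Q₁` and `Ψ₂` on `pullK Q₂` (`Q₁`, `Q₂` open Kerr-side sets) which agree on `pullK (Q₁ ∩ Q₂)` and
  satisfy the cross-injectivity `Ψ₁ x = Ψ₂ x' ⇒ x' ∈ pullK Q₁` glue (`Ψ = Ψ₁` on `pullK Q₁`, `= Ψ₂` on
  `pullK Q₂`) to an exact chart on `pullK (Q₁ ∪ Q₂)` (everything is local except injectivity);
* `mem_of_kite_eq` — the CROSS-INJECTIVITY for the kite piece: if `Ψ₁(pullK Q₁)` is past-closed in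
  `I⁺(C)` (conclusion of `K2Route.ExactChartPastSet`) and lies in `I⁺(C)`, and `Θ : U → 𝒮` is a
  continuous map of an open Kerr-side sub-spacetime sending future timelike curves of `U` to future
  timelike curves, agreeing with `Ψ₁ ∘ lab` on `U ∩ Q₁`, and every point of `U ∖ Q₁` is the future end
  of a timelike curve of `U` starting in `Q₁` (the kite over its slice), then `Θ z = Ψ₁ x`, `x ∈ pullK Q₁`,
  forces `z ∈ Q₁`: along the curve the FIRST EXIT point from `Q₁` would have its image in
  `J⁻(Ψ₁ x) ∩ I⁺(C) ⊆ Ψ₁(pullK Q₁)`, and the open embedding `Ψ₁|pullK Q₁` forces the exit point into `Q₁`.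

References: Dafermos–Rodnianski arXiv:0811.0354, §5.1 [DafermosRodnianski2008]; O'Neill 1983, Ch. 14,
p. 402 [ONeill1983].  No definitions, no named facts.
-/

noncomputable section

-- D-0017: single-problem summit, `Summit.<S>.<S>.…` by design (cf. lakefile `weak.linter.dupNamespace`).
set_option linter.dupNamespace false
set_option maxSynthPendingDepth 3

open Set Filter Function Topology TopologicalSpace Bundle
open Literature.Geometry.Lorentzian
open scoped Manifold ContDiff Topology ENNReal

namespace Summit.FinalStateConjecture.FinalStateConjecture.Theorems.BondiBartnikRigidity.DirectMethod

namespace ChartGlue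

open ChartData (lab_mem_pullK_iff deviation_eq_zero_of_exact)
open F1Route (supCkENorm_zero_le_of_forall_eq_zero)

variable [Kerr.Facts] {𝒮 : Spacetime.{0} 4} {mo : lorentzGroup × E4} {M a : ℝ} {B : ModelBackground}

/-! ### Gluing two exact charts -/

omit [Kerr.Facts] in
/-- **Two exact charts agreeing on the overlap, with the cross-injectivity, glue to an exact chart.**
[cite: DafermosRodnianski2008, §5.1] -/
theorem glue (hB : B = starBackground mo.1 mo.2 M a (fun x => Kerr.radius a (poincareInv mo.1 mo.2 x)))
    {Q₁ Q₂ : Set (Kerr.region a M)} (hQ₁ : IsOpen Q₁) (hQ₂ : IsOpen Q₂)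
    {Ψ₁ Ψ₂ : B.domain → 𝒮.carrier}
    (hs₁ : ContMDiffOn 𝓘(ℝ, E4) (𝓡 4) ∞ Ψ₁ (pullK mo M a B Q₁))
    (he₁ : IsOpenEmbedding ((pullK mo M a B Q₁).restrict Ψ₁))
    (hd₁ : supCkENorm (Subtype.val '' pullK mo M a B Q₁) 0 (𝒮.deviationExtend B Ψ₁) ≤ 0)
    (htop₁ : ∀ x ∈ pullK mo M a B Q₁, 𝒮.timeOrientation.IsFutureDirected
      (mfderiv 𝓘(ℝ, E4) (𝓡 4) Ψ₁ x ((mo.1 : E4 ≃L[ℝ] E4) (Kerr.timeVector M a (poincareInv mo.1 mo.2 x.1)))))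
    (hs₂ : ContMDiffOn 𝓘(ℝ, E4) (𝓡 4) ∞ Ψ₂ (pullK mo M a B Q₂))
    (he₂ : IsOpenEmbedding ((pullK mo M a B Q₂).restrict Ψ₂))
    (hd₂ : supCkENorm (Subtype.val '' pullK mo M a B Q₂) 0 (𝒮.deviationExtend B Ψ₂) ≤ 0)
    (htop₂ : ∀ x ∈ pullK mo M a B Q₂, 𝒮.timeOrientation.IsFutureDirected
      (mfderiv 𝓘(ℝ, E4) (𝓡 4) Ψ₂ x ((mo.1 : E4 ≃L[ℝ] E4) (Kerr.timeVector M a (poincareInv mo.1 mo.2 x.1)))))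
    (hagree : ∀ x ∈ pullK mo M a B Q₁, x ∈ pullK mo M a B Q₂ → Ψ₁ x = Ψ₂ x)
    (hcross : ∀ x ∈ pullK mo M a B Q₁, ∀ x' ∈ pullK mo M a B Q₂, Ψ₁ x = Ψ₂ x' → x' ∈ pullK mo M a B Q₁) :
    ∃ Ψ : B.domain → 𝒮.carrier,
      ContMDiffOn 𝓘(ℝ, E4) (𝓡 4) ∞ Ψ (pullK mo M a B (Q₁ ∪ Q₂)) ∧
      IsOpenEmbedding ((pullK mo M a B (Q₁ ∪ Q₂)).restrict Ψ) ∧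
      supCkENorm (Subtype.val '' pullK mo M a B (Q₁ ∪ Q₂)) 0 (𝒮.deviationExtend B Ψ) ≤ 0 ∧
      (∀ x ∈ pullK mo M a B (Q₁ ∪ Q₂), 𝒮.timeOrientation.IsFutureDirected
        (mfderiv 𝓘(ℝ, E4) (𝓡 4) Ψ x ((mo.1 : E4 ≃L[ℝ] E4) (Kerr.timeVector M a (poincareInv mo.1 mo.2 x.1))))) ∧
      (∀ x ∈ pullK mo M a B Q₁, Ψ x = Ψ₁ x) ∧ (∀ x ∈ pullK mo M a B Q₂, Ψ x = Ψ₂ x) := by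
  classical
  set P₁ := pullK mo M a B Q₁ with hP₁
  set P₂ := pullK mo M a B Q₂ with hP₂
  have hP₁o : IsOpen P₁ := K2Route.isOpen_pullK_of_eq hB hQ₁
  have hP₂o : IsOpen P₂ := K2Route.isOpen_pullK_of_eq hB hQ₂
  have hPU : pullK mo M a B (Q₁ ∪ Q₂) = P₁ ∪ P₂ := by
    ext x; constructor
    · rintro ⟨h, h₁ | h₂⟩
      · exact Or.inl ⟨h, h₁⟩
      · exact Or.inr ⟨h, h₂⟩
    · rintro (⟨h, h₁⟩ | ⟨h, h₂⟩)
      · exact ⟨h, Or.inl h₁⟩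
      · exact ⟨h, Or.inr h₂⟩
  let Ψ : B.domain → 𝒮.carrier := fun x => if x ∈ P₁ then Ψ₁ x else Ψ₂ x
  have hΨ₁ : ∀ x ∈ P₁, Ψ x = Ψ₁ x := fun x hx => if_pos hx
  have hΨ₂ : ∀ x ∈ P₂, Ψ x = Ψ₂ x := fun x hx => by
    by_cases h : x ∈ P₁
    · rw [hΨ₁ x h]; exact hagree x h hx
    · exact if_neg h
  -- `Ψ` is locally `Ψ₁` or `Ψ₂`
  have hev₁ : ∀ x ∈ P₁, Ψ =ᶠ[𝓝 x] Ψ₁ := fun x hx => by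
    filter_upwards [hP₁o.mem_nhds hx] with y hy; exact hΨ₁ y hy
  have hev₂ : ∀ x ∈ P₂, Ψ =ᶠ[𝓝 x] Ψ₂ := fun x hx => by
    filter_upwards [hP₂o.mem_nhds hx] with y hy; exact hΨ₂ y hy
  rw [hPU]
  refine ⟨Ψ, ?_, ?_, ?_, ?_, hΨ₁, hΨ₂⟩
  · -- smooth
    rintro x (hx | hx)
    · exact (((hs₁ x hx).contMDiffAt (hP₁o.mem_nhds hx)).congr_of_eventuallyEq (hev₁ x hx)).contMDiffWithinAt
    · exact (((hs₂ x hx).contMDiffAt (hP₂o.mem_nhds hx)).congr_of_eventuallyEq (hev₂ x hx)).contMDiffWithinAt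
  · -- open embedding: continuous, injective, open
    refine IsOpenEmbedding.of_continuous_injective_isOpenMap ?_ ?_ ?_
    · refine continuousOn_iff_continuous_restrict.1 ?_
      rintro x (hx | hx)
      · exact (((hs₁ x hx).contMDiffAt (hP₁o.mem_nhds hx)).congr_of_eventuallyEq
          (hev₁ x hx)).continuousAt.continuousWithinAt
      · exact (((hs₂ x hx).contMDiffAt (hP₂o.mem_nhds hx)).congr_of_eventuallyEq
          (hev₂ x hx)).continuousAt.continuousWithinAt
    · rintro ⟨x, hx⟩ ⟨y, hy⟩ hxy
      have hxy' : Ψ x = Ψ y := hxy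
      have key : ∀ {x y}, x ∈ P₁ → y ∈ P₁ ∪ P₂ → Ψ x = Ψ y → x = y := by
        intro x y hx hy hxy
        have hyP₁ : y ∈ P₁ := by
          rcases hy with hy | hy
          · exact hy
          · rw [hΨ₁ x hx, hΨ₂ y hy] at hxy
            exact hcross x hx y hy hxy
        rw [hΨ₁ x hx, hΨ₁ y hyP₁] at hxy
        exact congrArg Subtype.val (he₁.injective (a₁ := ⟨x, hx⟩) (a₂ := ⟨y, hyP₁⟩) hxy)
      have goal : x = y := by
        rcases hx with hx | hx
        · exact key hx hy hxy'
        · rcases hy with hy | hy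
          · exact (key hy (Or.inr hx) hxy'.symm).symm
          · rw [hΨ₂ x hx, hΨ₂ y hy] at hxy'
            exact congrArg Subtype.val (he₂.injective (a₁ := ⟨x, hx⟩) (a₂ := ⟨y, hy⟩) hxy')
      exact Subtype.ext goal
    · -- open map: on the open cover by `P₁`, `P₂` it is `Ψ₁`, `Ψ₂`
      intro O hO
      have hOeq : (P₁ ∪ P₂).restrict Ψ '' O =
          (P₁.restrict Ψ₁ '' {x : P₁ | (⟨x.1, Or.inl x.2⟩ : ↥(P₁ ∪ P₂)) ∈ O}) ∪
          (P₂.restrict Ψ₂ '' {x : P₂ | (⟨x.1, Or.inr x.2⟩ : ↥(P₁ ∪ P₂)) ∈ O}) := by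
        ext q; constructor
        · rintro ⟨⟨x, hx⟩, hxO, rfl⟩
          rcases hx with hx | hx
          · exact Or.inl ⟨⟨x, hx⟩, hxO, (hΨ₁ x hx).symm⟩
          · exact Or.inr ⟨⟨x, hx⟩, hxO, (hΨ₂ x hx).symm⟩
        · rintro (⟨⟨x, hx⟩, hxO, rfl⟩ | ⟨⟨x, hx⟩, hxO, rfl⟩)
          · exact ⟨_, hxO, hΨ₁ x hx⟩
          · exact ⟨_, hxO, hΨ₂ x hx⟩
      rw [hOeq]
      refine (he₁.isOpenMap _ ?_).union (he₂.isOpenMap _ ?_)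
      · exact hO.preimage (Continuous.subtype_mk continuous_subtype_val _)
      · exact hO.preimage (Continuous.subtype_mk continuous_subtype_val _)
  · -- exactness
    refine supCkENorm_zero_le_of_forall_eq_zero ?_
    rintro _ ⟨x, hx, rfl⟩
    rw [Spacetime.deviationExtend_coe]
    rcases hx with hx | hx
    · rw [show 𝒮.deviation B Ψ x = 𝒮.deviation B Ψ₁ x by
        ext v w; rw [Spacetime.deviation_apply, Spacetime.deviation_apply, (hev₁ x hx).mfderiv_eq, hΨ₁ x hx]]
      exact deviation_eq_zero_of_exact hd₁ hx
    · rw [show 𝒮.deviation B Ψ x = 𝒮.deviation B Ψ₂ x by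
        ext v w; rw [Spacetime.deviation_apply, Spacetime.deviation_apply, (hev₂ x hx).mfderiv_eq, hΨ₂ x hx]]
      exact deviation_eq_zero_of_exact hd₂ hx
  · -- orientation
    rintro x (hx | hx)
    · rw [(hev₁ x hx).mfderiv_eq]
      have h := htop₁ x hx
      have hgen : ∀ q, q = Ψ₁ x → 𝒮.timeOrientation.IsFutureDirected (x := q)
          (mfderiv 𝓘(ℝ, E4) (𝓡 4) Ψ₁ x ((mo.1 : E4 ≃L[ℝ] E4) (Kerr.timeVector M a (poincareInv mo.1 mo.2 x.1)))) := by
        rintro q rfl; exact h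
      exact hgen _ (hΨ₁ x hx)
    · rw [(hev₂ x hx).mfderiv_eq]
      have h := htop₂ x hx
      have hgen : ∀ q, q = Ψ₂ x → 𝒮.timeOrientation.IsFutureDirected (x := q)
          (mfderiv 𝓘(ℝ, E4) (𝓡 4) Ψ₂ x ((mo.1 : E4 ≃L[ℝ] E4) (Kerr.timeVector M a (poincareInv mo.1 mo.2 x.1)))) := by
        rintro q rfl; exact h
      exact hgen _ (hΨ₂ x hx)

/-! ### Cross-injectivity across the kite -/

/-- **Cross-injectivity for the kite piece** (see the module docstring): `Θ z = Ψ₁ x` with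
`x ∈ pullK Q₁` forces `z ∈ Q₁`. [cite: DafermosRodnianski2008, §5.1] -/
theorem mem_of_kite_eq (hM : 0 < M) {lab : Kerr.region a M → B.domain}
    (hlab : ∀ z, (lab z : E4) = (mo.1 : E4 ≃L[ℝ] E4) z.1 + mo.2)
    (hB : B = starBackground mo.1 mo.2 M a (fun x => Kerr.radius a (poincareInv mo.1 mo.2 x)))
    {Q₁ : Set (Kerr.region a M)} (hQ₁ : IsOpen Q₁) {Ψ₁ : B.domain → 𝒮.carrier}
    (he₁ : IsOpenEmbedding ((pullK mo M a B Q₁).restrict Ψ₁))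
    {C : Set 𝒮.carrier}
    (hpast : ∀ x ∈ pullK mo M a B Q₁, 𝒮.metric.causalPast 𝒮.timeOrientation {Ψ₁ x} ∩
      𝒮.metric.chronologicalFuture 𝒮.timeOrientation C ⊆ Ψ₁ '' pullK mo M a B Q₁)
    (hQI : Ψ₁ '' pullK mo M a B Q₁ ⊆ 𝒮.metric.chronologicalFuture 𝒮.timeOrientation C)
    (U : Opens (Kerr.spacetime M a M hM.le).carrier) {Θ : U → 𝒮.carrier}
    (hΘs : ContMDiff 𝓘(ℝ, E4) (𝓡 4) ∞ Θ)
    (hΘi : ∀ y : U, pullbackBilin (I := 𝓡 4) (I' := 𝓘(ℝ, E4)) Θ 𝒮.metric.val y =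
      ((Kerr.spacetime M a M hM.le).metric.restrict PseudoRiemannianMetric.contMDiff_restrict_holds U).val y)
    (hΘt : ((Kerr.spacetime M a M hM.le).timeOrientation.restrict PseudoRiemannianMetric.contMDiff_restrict_holds
        (Kerr.spacetime M a M hM.le).timeOrientation.contMDiff_restrict_holds U).PreservesTimeOrientation
        Θ 𝒮.timeOrientation)
    (hagreeU : ∀ z : U, (z.1 : Kerr.region a M) ∈ Q₁ → Θ z = Ψ₁ (lab z.1))
    (hcurve : ∀ z : U, (z.1 : Kerr.region a M) ∉ Q₁ → ∃ y₀ : U, (y₀.1 : Kerr.region a M) ∈ Q₁ ∧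
      z ∈ ((Kerr.spacetime M a M hM.le).metric.restrict PseudoRiemannianMetric.contMDiff_restrict_holds
        U).chronologicalFuture ((Kerr.spacetime M a M hM.le).timeOrientation.restrict
          PseudoRiemannianMetric.contMDiff_restrict_holds
          (Kerr.spacetime M a M hM.le).timeOrientation.contMDiff_restrict_holds U) {y₀})
    (z : U) {x : B.domain} (hx : x ∈ pullK mo M a B Q₁) (hzx : Θ z = Ψ₁ x) :
    (z.1 : Kerr.region a M) ∈ Q₁ := by
  have hn1 : (1 : ℕ∞ω) ≤ (∞ : ℕ∞ω) := by exact_mod_cast le_top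
  by_contra hzQ
  obtain ⟨y₀, hy₀, hzy₀⟩ := hcurve z hzQ
  obtain ⟨p, hp, γ, b₀, b₁, hb, hγ, hγp, hγz⟩ := hzy₀
  rw [mem_singleton_iff] at hp
  rw [hp] at hγp
  set P₁ := pullK mo M a B Q₁ with hP₁
  have hP₁o : IsOpen P₁ := K2Route.isOpen_pullK_of_eq hB hQ₁
  have hinj : InjOn Ψ₁ P₁ := fun x hx y hy hxy =>
    congrArg Subtype.val (he₁.injective (a₁ := ⟨x, hx⟩) (a₂ := ⟨y, hy⟩) hxy)
  -- the image curve `c₁ = Θ ∘ γ` lies in `Ψ₁(pullK Q₁)`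
  have hc₁ : 𝒮.metric.IsFutureTimelikeCurveOn 𝒮.timeOrientation (Θ ∘ γ) (Icc b₀ b₁) :=
    hγ.comp_isIsometricImmersion (hΘs.mdifferentiable (by simp)) hΘt hΘi
  have hstart : (Θ ∘ γ) b₀ ∈ Ψ₁ '' P₁ := by
    refine ⟨lab y₀.1, (lab_mem_pullK_iff hlab _).2 hy₀, ?_⟩
    show Ψ₁ (lab y₀.1) = Θ (γ b₀)
    rw [hγp]; exact (hagreeU y₀ hy₀).symm
  have hcP : ∀ t ∈ Icc b₀ b₁, (Θ ∘ γ) t ∈ Ψ₁ '' P₁ := by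
    intro t ht
    refine hpast x hx ⟨?_, ?_⟩
    · refine LorentzianMetric.mem_causalPast_of_mem_causalFuture ?_
      rw [← hzx, ← hγz]
      rcases eq_or_lt_of_le ht.2 with heq | hlt
      · rw [heq]; exact Or.inl (mem_singleton _)
      · exact Or.inr ⟨_, mem_singleton _, Θ ∘ γ, t, b₁, hlt,
          hc₁.isFutureCausalCurveOn.mono (Icc_subset_Icc ht.1 le_rfl), rfl, rfl⟩
    · have h0 : (Θ ∘ γ) b₀ ∈ 𝒮.metric.chronologicalFuture 𝒮.timeOrientation C := hQI hstart
      rcases eq_or_lt_of_le ht.1 with heq | hlt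
      · rw [← heq]; exact h0
      · exact LorentzianMetric.mem_chronologicalFuture_trans h0
          ⟨_, mem_singleton _, Θ ∘ γ, b₀, t, hlt, hc₁.mono (Icc_subset_Icc le_rfl ht.2), rfl, rfl⟩
  -- the first exit parameter from `Q₁`
  have hγc : ∀ t ∈ Icc b₀ b₁, ContinuousAt γ t := fun t ht => (hγ t ht).1.continuousAt
  set X : Set ℝ := {t ∈ Icc b₀ b₁ | ((γ t).1 : Kerr.region a M) ∉ Q₁} with hX
  have hXc : IsClosed X := by
    have hcont : ContinuousOn (fun t => ((γ t).1 : Kerr.region a M)) (Icc b₀ b₁) := fun t ht =>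
      (continuous_subtype_val.continuousAt.comp (hγc t ht)).continuousWithinAt
    exact hcont.preimage_isClosed_of_isClosed isClosed_Icc hQ₁.isClosed_compl
  have hb₁X : b₁ ∈ X := ⟨right_mem_Icc.2 hb.le, by rw [hγz]; exact hzQ⟩
  have hXne : X.Nonempty := ⟨b₁, hb₁X⟩
  have hXbdd : BddBelow X := ⟨b₀, fun t ht => ht.1.1⟩
  set s₀ := sInf X with hs₀
  have hs₀X : s₀ ∈ X := hXc.csInf_mem hXne hXbdd
  have hs₀I : s₀ ∈ Icc b₀ b₁ := hs₀X.1
  have hbefore : ∀ t ∈ Ico b₀ s₀, ((γ t).1 : Kerr.region a M) ∈ Q₁ := by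
    intro t ht
    by_contra h
    have : s₀ ≤ t := csInf_le hXbdd ⟨⟨ht.1, ht.2.le.trans hs₀I.2⟩, h⟩
    exact absurd this (not_le.2 ht.2)
  have hs₀b₀ : b₀ < s₀ := by
    rcases eq_or_lt_of_le hs₀I.1 with h | h
    · exfalso; apply hs₀X.2; rw [← h, hγp]; exact hy₀
    · exact h
  -- the image of the exit point has a preimage `x₀ ∈ pullK Q₁`
  obtain ⟨x₀, hx₀, hx₀eq⟩ := hcP s₀ hs₀I
  -- `lab (γ t) → x₀` as `t ↑ s₀`
  have hlim₁ : Tendsto (fun t => lab ((γ t).1 : Kerr.region a M)) (𝓝[<] s₀) (𝓝 x₀) := by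
    rw [tendsto_nhds]
    intro N' hN'o hx₀N'
    set N'' : Set B.domain := N' ∩ P₁ with hN''
    have hN''o : IsOpen N'' := hN'o.inter hP₁o
    have himg : IsOpen (Ψ₁ '' N'') := by
      have h1 : Ψ₁ '' N'' = P₁.restrict Ψ₁ '' (Subtype.val ⁻¹' N'') := by
        ext q; constructor
        · rintro ⟨y, hy, rfl⟩; exact ⟨⟨y, hy.2⟩, hy, rfl⟩
        · rintro ⟨⟨y, hyP⟩, hy, rfl⟩; exact ⟨y, hy, rfl⟩
      rw [h1]
      exact he₁.isOpenMap _ (hN''o.preimage continuous_subtype_val)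
    have hcts : ContinuousAt (Θ ∘ γ) s₀ := (hc₁ s₀ hs₀I).1.continuousAt
    have hmem : ∀ᶠ t in 𝓝 s₀, (Θ ∘ γ) t ∈ Ψ₁ '' N'' :=
      hcts.preimage_mem_nhds (himg.mem_nhds ⟨x₀, ⟨hx₀N', hx₀⟩, hx₀eq⟩)
    have hmem' : ∀ᶠ t in 𝓝[<] s₀, (Θ ∘ γ) t ∈ Ψ₁ '' N'' ∧ t ∈ Ioo b₀ s₀ :=
      (hmem.filter_mono nhdsWithin_le_nhds).and (Ioo_mem_nhdsLT hs₀b₀)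
    refine mem_map.2 (hmem'.mono ?_)
    rintro t ⟨⟨y, hyN'', hyeq⟩, htI⟩
    have hγt : ((γ t).1 : Kerr.region a M) ∈ Q₁ := hbefore t ⟨htI.1.le, htI.2⟩
    have heq : Ψ₁ y = Ψ₁ (lab ((γ t).1 : Kerr.region a M)) := by
      rw [hyeq]; exact hagreeU (γ t) hγt
    have := hinj hyN''.2 ((lab_mem_pullK_iff hlab _).2 hγt) heq
    show lab ((γ t).1 : Kerr.region a M) ∈ N'
    rw [← this]; exact hyN''.1
  have hlim₂ : Tendsto (fun t => lab ((γ t).1 : Kerr.region a M)) (𝓝[<] s₀)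
      (𝓝 (lab ((γ s₀).1 : Kerr.region a M))) := by
    have hlc : Continuous lab := (ChartData.contMDiff_lab hlab).1.continuous
    exact ((hlc.continuousAt.comp (continuous_subtype_val.continuousAt.comp (hγc s₀ hs₀I))).tendsto).mono_left
      nhdsWithin_le_nhds
  have heq := tendsto_nhds_unique hlim₂ hlim₁
  apply hs₀X.2
  have : lab ((γ s₀).1 : Kerr.region a M) ∈ P₁ := by rw [heq]; exact hx₀
  exact (lab_mem_pullK_iff (mo := mo) (B := B) hlab _).1 this

end ChartGlue

/-- **Registered bookkeeping sub-goal `stub_pullKUnion` of the line** (brick of the landing of K2b-5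
`stub_marchingLemma`): the pull-back of a union is the union of the pull-backs (anchor of this file, whose
content is the gluing of exact charts `ChartGlue.glue` and the cross-injectivity across the kite
`ChartGlue.mem_of_kite_eq`). [folklore] -/
theorem stub_pullKUnion : ∀ (mo : lorentzGroup × E4) (M a : ℝ) (B : ModelBackground) (Q₁ Q₂ : Set (Kerr.region a M)),
    pullK mo M a B (Q₁ ∪ Q₂) = pullK mo M a B Q₁ ∪ pullK mo M a B Q₂ := by
  intro mo M a B Q₁ Q₂
  ext x; constructor
  · rintro ⟨h, h₁ | h₂⟩
    · exact Or.inl ⟨h, h₁⟩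
    · exact Or.inr ⟨h, h₂⟩
  · rintro (⟨h, h₁⟩ | ⟨h, h₂⟩)
    · exact ⟨h, Or.inl h₁⟩
    · exact ⟨h, Or.inr h₂⟩

end Summit.FinalStateConjecture.FinalStateConjecture.Theorems.BondiBartnikRigidity.DirectMethod

end
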